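import Literature.AlgebraicGeometry.Motives.QuadricStrataIdeals
import Literature.AlgebraicGeometry.Motives.CellularPeeling
import HarnessLib

/-!
# The cells of the quadric strata and their renormalisation

## Cells: `T(s, m+2) ∩ D₊(x_s) ≅ 𝔸^{N-s-1}`

For the stratum `T(s, m+2) = V₊(x₀, …, x_{s-1}, x_s x_{s+1} + q_{s+2,m}) ⊆ ℙᴺ` of the split quadric
(`Motives/QuadricStrataIdeals`), the open part over `D₊(x_s)` is an affine space: in the chart
`D₊(x_s) ≅ Spec k[y]` it is the graph `y_s = -q(y)` over the free coordinates
`x_{s+2}/x_s, …, x_N/x_s` (Fulton, *Intersection Theory*, Example 1.9.1: the cells of a quadric).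
We build the closed immersion `cellMap : 𝔸ᴰ ↪ 𝔸ᴺ` (`D = N - s - 1`), compute its kernel by the
section method (`ker_eq_of_section`), identify its image with the chart trace of the stratum
(`chartι_preimage_stratum`), and conclude, for a closed immersion `e : Y ↪ ℙᴺ` from a reduced
scheme with image `T(s, m+2)`, that `e⁻¹ D₊(x_s) ≅ Spec k[Fin D]` and `A₁(e⁻¹ D₊(x_s)) = 0` when
`D ≥ 2` (`cyclesOfDim_one_preimage_basicOpen_stratum_le`).

## Renormalisation of the complement by a coordinate permutation

After peeling the cell `D₊(x_s)` off `T(s, m+2)`, what is left is the cone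
`C(s, m) = V₊(x₀, …, x_s, q_{s+2,m})`, in which the vertex variable `x_{s+1}` sits between the
killed block and the quadric block. The coordinate permutation `ρ` cycling `x_{s+1}` past the
quadric block (`shiftPerm`) renormalises it: for the projective linear transformation `σ_ρ`
(`Motives/ProjectiveSpaceLinearSubst.substMapHom` of the substitution `xⱼ ↦ x_{ρ j}`),
`σ_ρ⁻¹ T(s+1, m) = C(s, m)` (`shiftMap_preimage_stratum`), so `σ_ρ` maps `C(s, m)` onto the
stratum `T(s+1, m)` of the same shape one level down. We also record the generic point of
`C(s, m)` for `m ≥ 3` (`conePoint`, `closure_conePoint`) and that points of `T(s, m+2)` off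
`D₊(x_s)` lie on `C(s, m)` (`mem_coneSet_of_notMem_basicOpen`).

Everything is proved; no named facts. (Helper file toward the quadric cases of
`TianZong2014_chowOne_generatedByLines`, `Motives/LinesGenerateChowOne`.)

## References

* W. Fulton, *Intersection Theory*, Example 1.9.1. [Fulton1998]
* R. Hartshorne, *Algebraic Geometry*, II Prop. 2.5, II Example 7.1.1. [Hartshorne1977]
-/

noncomputable section

open CategoryTheory AlgebraicGeometry Order

universe u

namespace Literature.AlgebraicGeometry.Motives

namespace ProjectiveSpaceCells

open _root_.MvPolynomial

/-! ### Kernels by the section method -/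

section KerSection

variable {k : Type u} [Field k] {σ τ : Type*}

/-- **Kernel by the section method.** If `J ≤ ker φ` and `ψ (φ xⱼ) ≡ xⱼ (mod J)` for all variables,
then `ker φ = J` (modulo `J`, every polynomial agrees with `ψ (φ p)`). [folklore] -/
theorem ker_eq_of_section (φ : MvPolynomial σ k →ₐ[k] MvPolynomial τ k)
    (ψ : MvPolynomial τ k →ₐ[k] MvPolynomial σ k) (J : Ideal (MvPolynomial σ k))
    (hJ : J ≤ RingHom.ker φ) (hX : ∀ j, ψ (φ (MvPolynomial.X j)) - MvPolynomial.X j ∈ J) :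
    RingHom.ker φ = J := by
  refine le_antisymm (fun p hp ↦ ?_) hJ
  have hπ : (Ideal.Quotient.mkₐ k J).comp (ψ.comp φ) = Ideal.Quotient.mkₐ k J := by
    refine MvPolynomial.algHom_ext fun j ↦ ?_
    simp only [AlgHom.coe_comp, Function.comp_apply, Ideal.Quotient.mkₐ_eq_mk]
    exact Ideal.Quotient.eq.mpr (hX j)
  have h := congr($hπ p)
  rw [RingHom.mem_ker] at hp
  simp only [AlgHom.coe_comp, Function.comp_apply, Ideal.Quotient.mkₐ_eq_mk, hp, map_zero] at h
  exact Ideal.Quotient.eq_zero_iff_mem.mp h.symm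

end KerSection

/-! ### The cell map `𝔸ᴰ ↪ 𝔸ᴺ` -/

section Cell

variable (k : Type u) [Field k] {N : ℕ}

attribute [local instance] MvPolynomial.gradedAlgebra ProjBaseChange.algebraBase

local notation "𝓐" => MvPolynomial.homogeneousSubmodule (Fin (N + 1)) k

variable {k} in
/-- The chart index `s`. [folklore] -/
def cs (s D : ℕ) (hD : s + 1 + D = N) : Fin (N + 1) := ⟨s, by omega⟩

variable {k} in
/-- The value of `succAbove` at the chart index `s`: `j ↦ j` below `s`, `j ↦ j + 1` from `s` on.
[folklore] -/
theorem val_succAbove_cs (s D : ℕ) (hD : s + 1 + D = N) (j : Fin N) :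
    ((cs s D hD).succAbove j : ℕ) = if (j : ℕ) < s then (j : ℕ) else (j : ℕ) + 1 := by
  by_cases hj : (j : ℕ) < s
  · rw [if_pos hj, Fin.succAbove_of_castSucc_lt _ _ (by rw [Fin.lt_def, Fin.val_castSucc]; exact hj),
      Fin.val_castSucc]
  · rw [if_neg hj, Fin.succAbove_of_le_castSucc _ _ (by
      rw [Fin.le_def, Fin.val_castSucc]; exact not_lt.mp hj), Fin.val_succ]

/-- The remainder `q_{s+2,m}` dehomogenised at `x_s` (a polynomial in `y_j`, `j ≥ s + 1`).
[folklore] -/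
def rY (s m D : ℕ) (hD : s + 1 + D = N) (hmD : m ≤ D) : MvPolynomial (Fin N) k :=
  ProjectiveSpace.dehomogenize k (cs s D hD) (splitFormAt k (s + 2) m (by omega))

/-- The plain substitution `y_j ↦ z_{j-s-1}` (`j ≥ s+1`), `y_j ↦ 0` (`j ≤ s`). [folklore] -/
def cellFwd₀ (s D : ℕ) (hD : s + 1 + D = N) : MvPolynomial (Fin N) k →ₐ[k] MvPolynomial (Fin D) k :=
  MvPolynomial.aeval fun j ↦ if h : s + 1 ≤ (j : ℕ) then MvPolynomial.X ⟨(j : ℕ) - (s + 1), by omega⟩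
    else 0

/-- **The cell map** `k[y] → k[z]`: `y_j ↦ 0` (`j < s`), `y_s ↦ -q(z)`, `y_j ↦ z_{j-s-1}` (`j > s`).
[cite: Fulton1998, Example 1.9.1] -/
def cellFwd (s m D : ℕ) (hD : s + 1 + D = N) (hmD : m ≤ D) : MvPolynomial (Fin N) k →ₐ[k] MvPolynomial (Fin D) k :=
  MvPolynomial.aeval fun j ↦ if h : s + 1 ≤ (j : ℕ) then MvPolynomial.X ⟨(j : ℕ) - (s + 1), by omega⟩
    else if (j : ℕ) = s then -cellFwd₀ k s D hD (rY k s m D hD hmD) else 0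

/-- The section `z_t ↦ y_{s+1+t}`. [folklore] -/
def cellBwd (s D : ℕ) (hD : s + 1 + D = N) : MvPolynomial (Fin D) k →ₐ[k] MvPolynomial (Fin N) k :=
  MvPolynomial.aeval fun t ↦ MvPolynomial.X ⟨s + 1 + (t : ℕ), by omega⟩

/-- Auxiliary computation (`cellFwd_X_lt`). [folklore] -/
theorem cellFwd_X_lt (s m D : ℕ) (hD : s + 1 + D = N) (hmD : m ≤ D) {j : Fin N} (hj : (j : ℕ) < s) : cellFwd k s m D hD hmD (MvPolynomial.X j) = 0 := by
  simp only [cellFwd, MvPolynomial.aeval_X]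
  rw [dif_neg (by omega), if_neg (by omega)]

/-- Auxiliary computation (`cellFwd_X_cs`). [folklore] -/
theorem cellFwd_X_cs (s m D : ℕ) (hD : s + 1 + D = N) (hmD : m ≤ D) : cellFwd k s m D hD hmD (MvPolynomial.X ⟨s, by omega⟩) =
    -cellFwd₀ k s D hD (rY k s m D hD hmD) := by
  simp only [cellFwd, MvPolynomial.aeval_X]
  rw [dif_neg (by simp)]
  simp

/-- Auxiliary computation (`cellFwd_X_gt`). [folklore] -/
theorem cellFwd_X_gt (s m D : ℕ) (hD : s + 1 + D = N) (hmD : m ≤ D) {j : Fin N} (hj : s + 1 ≤ (j : ℕ)) :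
    cellFwd k s m D hD hmD (MvPolynomial.X j) = MvPolynomial.X ⟨(j : ℕ) - (s + 1), by omega⟩ := by
  simp only [cellFwd, MvPolynomial.aeval_X]
  rw [dif_pos hj]

/-- Auxiliary computation (`cellFwd₀_X_gt`). [folklore] -/
theorem cellFwd₀_X_gt (s D : ℕ) (hD : s + 1 + D = N) {j : Fin N} (hj : s + 1 ≤ (j : ℕ)) :
    cellFwd₀ k s D hD (MvPolynomial.X j) = MvPolynomial.X ⟨(j : ℕ) - (s + 1), by omega⟩ := by
  simp only [cellFwd₀, MvPolynomial.aeval_X]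
  rw [dif_pos hj]

/-- Auxiliary computation (`cellFwd₀_X_le`). [folklore] -/
theorem cellFwd₀_X_le (s D : ℕ) (hD : s + 1 + D = N) {j : Fin N} (hj : ¬ s + 1 ≤ (j : ℕ)) : cellFwd₀ k s D hD (MvPolynomial.X j) = 0 := by
  simp only [cellFwd₀, MvPolynomial.aeval_X]
  rw [dif_neg hj]

/-- `cellFwd ∘ cellBwd = id`. [folklore] -/
theorem cellFwd_comp_cellBwd (s m D : ℕ) (hD : s + 1 + D = N) (hmD : m ≤ D) : (cellFwd k s m D hD hmD).comp (cellBwd k s D hD) = AlgHom.id k _ := by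
  refine MvPolynomial.algHom_ext fun t ↦ ?_
  simp only [AlgHom.coe_comp, Function.comp_apply, cellBwd, MvPolynomial.aeval_X, AlgHom.coe_id, id_eq]
  rw [cellFwd_X_gt k s m D hD hmD (by simp)]
  congr 1
  exact Fin.ext (by simp)

/-- `cellFwd₀ ∘ cellBwd = id`. [folklore] -/
theorem cellFwd₀_comp_cellBwd (s D : ℕ) (hD : s + 1 + D = N) : (cellFwd₀ k s D hD).comp (cellBwd k s D hD) = AlgHom.id k _ := by
  refine MvPolynomial.algHom_ext fun t ↦ ?_
  simp only [AlgHom.coe_comp, Function.comp_apply, cellBwd, MvPolynomial.aeval_X, AlgHom.coe_id, id_eq]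
  rw [cellFwd₀_X_gt k s D hD (by simp)]
  congr 1
  exact Fin.ext (by simp)

open scoped Classical in
/-- The idempotent `κ = cellBwd ∘ cellFwd₀` kills `y_j`, `j ≤ s`, and fixes `y_j`, `j > s`; it
commutes with dehomogenisation up to killing `x_j (j < s)` and `x_{s+1}`. [folklore] -/
theorem cellBwd_cellFwd₀_comp_dehomogenize (s D : ℕ) (hD : s + 1 + D = N) :
    ((cellBwd k s D hD).comp (cellFwd₀ k s D hD)).comp
        (ProjectiveSpace.dehomogenize k (cs s D hD)) =
      (ProjectiveSpace.dehomogenize k (cs s D hD)).comp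
        (killSet k ({j : Fin (N + 1) | (j : ℕ) < s} ∪ {⟨s + 1, by omega⟩})) := by
  refine MvPolynomial.algHom_ext fun i ↦ ?_
  simp only [AlgHom.coe_comp, Function.comp_apply]
  rcases Fin.eq_self_or_eq_succAbove (cs s D hD) i with rfl | ⟨j, rfl⟩
  · -- `i = s`: both sides are `1`
    rw [ProjectiveSpace.dehomogenize_X_self, map_one, map_one, killSet_X_of_notMem,
      ProjectiveSpace.dehomogenize_X_self]
    simp [cs]
  · rw [ProjectiveSpace.dehomogenize_X_succAbove]
    have hv := val_succAbove_cs s D hD j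
    by_cases hj : (j : ℕ) < s
    · rw [if_pos hj] at hv
      rw [cellFwd₀_X_le k s D hD (by omega), map_zero, killSet_X_of_mem, map_zero]
      left; simpa [hv] using hj
    · rw [if_neg hj] at hv
      by_cases hjs : (j : ℕ) = s
      · rw [cellFwd₀_X_le k s D hD (by omega), map_zero, killSet_X_of_mem, map_zero]
        right; rw [Set.mem_singleton_iff]; exact Fin.ext (by rw [hv, hjs])
      · rw [cellFwd₀_X_gt k s D hD (by omega), cellBwd, MvPolynomial.aeval_X, killSet_X_of_notMem,
          ProjectiveSpace.dehomogenize_X_succAbove]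
        · congr 1; exact Fin.ext (by simp; omega)
        · simp only [Set.mem_union, Set.mem_setOf_eq, Set.mem_singleton_iff, not_or]
          exact ⟨by omega, fun h ↦ by have := congrArg Fin.val h; simp at this; omega⟩

/-- `κ` fixes the dehomogenised remainder `rY`. [folklore] -/
theorem cellBwd_cellFwd₀_rY (s m D : ℕ) (hD : s + 1 + D = N) (hmD : m ≤ D) : cellBwd k s D hD (cellFwd₀ k s D hD (rY k s m D hD hmD)) = rY k s m D hD hmD := by
  classical
  have h := congr($(cellBwd_cellFwd₀_comp_dehomogenize k s D hD) (splitFormAt k (s + 2) m (by omega)))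
  simp only [AlgHom.coe_comp, Function.comp_apply] at h
  rw [rY, h, killSet_splitFormAt]
  rintro j (hj | hj)
  · left; simp only [Set.mem_setOf_eq] at hj; omega
  · left; rw [Set.mem_singleton_iff] at hj; rw [hj]; simp

/-- `cellFwd rY = cellFwd₀ rY` (on polynomials in `y_j`, `j > s`, the two maps agree). [folklore] -/
theorem cellFwd_rY (s m D : ℕ) (hD : s + 1 + D = N) (hmD : m ≤ D) : cellFwd k s m D hD hmD (rY k s m D hD hmD) = cellFwd₀ k s D hD (rY k s m D hD hmD) := by
  conv_lhs => rw [← cellBwd_cellFwd₀_rY k s m D hD hmD]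
  have h := congr($(cellFwd_comp_cellBwd k s m D hD hmD) (cellFwd₀ k s D hD (rY k s m D hD hmD)))
  simpa using h

/-- **The dehomogenised stratum equation**: `(x_s x_{s+1} + q)(y) = y_s + rY`. [folklore] -/
theorem dehomogenize_splitFormAt_cs (s m D : ℕ) (hD : s + 1 + D = N) (hmD : m ≤ D) :
    ProjectiveSpace.dehomogenize k (cs s D hD) (splitFormAt k s (m + 2) (by omega)) =
      MvPolynomial.X ⟨s, by omega⟩ + rY k s m D hD hmD := by
  rw [splitFormAt_add_two, map_add, map_mul, show (⟨s, by omega⟩ : Fin (N + 1)) = cs s D hD from rfl,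
    ProjectiveSpace.dehomogenize_X_self, one_mul, rY]
  congr 1
  have hsucc : (⟨s + 1, by omega⟩ : Fin (N + 1)) = (cs s D hD).succAbove ⟨s, by omega⟩ := by
    refine Fin.ext ?_
    rw [val_succAbove_cs s D hD, if_neg (lt_irrefl _)]
  rw [hsucc, ProjectiveSpace.dehomogenize_X_succAbove]

/-- The cell ideal `(y_j (j < s), y_s + rY)`. [folklore] -/
def cellIdealGens (s m D : ℕ) (hD : s + 1 + D = N) (hmD : m ≤ D) : Set (MvPolynomial (Fin N) k) :=
  (fun j ↦ (MvPolynomial.X j : MvPolynomial (Fin N) k)) '' {j : Fin N | (j : ℕ) < s} ∪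
    {MvPolynomial.X ⟨s, by omega⟩ + rY k s m D hD hmD}

/-- **`ker cellFwd = (y_j (j < s), y_s + rY)`.** [folklore] -/
theorem ker_cellFwd (s m D : ℕ) (hD : s + 1 + D = N) (hmD : m ≤ D) : RingHom.ker (cellFwd k s m D hD hmD) = Ideal.span (cellIdealGens k s m D hD hmD) := by
  refine ker_eq_of_section _ (cellBwd k s D hD) _ ?_ fun j ↦ ?_
  · rw [Ideal.span_le]
    rintro x (⟨j, hj, rfl⟩ | hx)
    · exact cellFwd_X_lt k s m D hD hmD hj
    · rw [Set.mem_singleton_iff] at hx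
      subst hx
      rw [SetLike.mem_coe, RingHom.mem_ker, map_add, cellFwd_X_cs, cellFwd_rY, neg_add_cancel]
  · by_cases hj : (j : ℕ) < s
    · rw [cellFwd_X_lt k s m D hD hmD hj, map_zero, zero_sub]
      exact Ideal.neg_mem_iff _ |>.mpr (Ideal.subset_span (Or.inl ⟨j, hj, rfl⟩))
    · by_cases hjs : (j : ℕ) = s
      · have hj' : j = ⟨s, by omega⟩ := Fin.ext hjs
        rw [hj', cellFwd_X_cs, map_neg, ← cellFwd_rY, show cellFwd k s m D hD hmD (rY k s m D hD hmD) =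
          cellFwd₀ k s D hD (rY k s m D hD hmD) from cellFwd_rY k s m D hD hmD, cellBwd_cellFwd₀_rY,
          show -rY k s m D hD hmD - MvPolynomial.X ⟨s, _⟩ = -(MvPolynomial.X ⟨s, by omega⟩ + rY k s m D hD hmD)
            by ring]
        exact Ideal.neg_mem_iff _ |>.mpr (Ideal.subset_span (Or.inr rfl))
      · rw [cellFwd_X_gt k s m D hD hmD (by omega), cellBwd, MvPolynomial.aeval_X,
          show (⟨s + 1 + (((⟨(j : ℕ) - (s + 1), _⟩ : Fin D)) : ℕ), _⟩ : Fin N) = j from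
            Fin.ext (by simp; omega), sub_self]
        exact zero_mem _

/-- `cellFwd` is surjective. [folklore] -/
theorem cellFwd_surjective (s m D : ℕ) (hD : s + 1 + D = N) (hmD : m ≤ D) : Function.Surjective (cellFwd k s m D hD hmD) := fun p ↦
  ⟨cellBwd k s D hD p, congr($(cellFwd_comp_cellBwd k s m D hD hmD) p)⟩

/-- **The cell as a closed immersion `𝔸ᴰ ↪ 𝔸ᴺ`.** [cite: Fulton1998, Example 1.9.1] -/
def cellMap (s m D : ℕ) (hD : s + 1 + D = N) (hmD : m ≤ D) : Spec (CommRingCat.of (MvPolynomial (Fin D) k)) ⟶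
    Spec (CommRingCat.of (MvPolynomial (Fin N) k)) :=
  Spec.map (CommRingCat.ofHom (cellFwd k s m D hD hmD).toRingHom)

/-- Auxiliary instance (`isClosedImmersion_cellMap`). [folklore] -/
instance isClosedImmersion_cellMap (s m D : ℕ) (hD : s + 1 + D = N) (hmD : m ≤ D) : IsClosedImmersion (cellMap k s m D hD hmD) :=
  IsClosedImmersion.spec_of_surjective _ (cellFwd_surjective k s m D hD hmD)

/-- The image of the cell map is `V(y_j (j<s), y_s + rY)`. [folklore] -/
theorem range_cellMap (s m D : ℕ) (hD : s + 1 + D = N) (hmD : m ≤ D) : Set.range (cellMap k s m D hD hmD).base =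
    PrimeSpectrum.zeroLocus (cellIdealGens k s m D hD hmD) := by
  change Set.range (PrimeSpectrum.comap (cellFwd k s m D hD hmD).toRingHom) = _
  rw [range_comap_of_surjective _ _ (cellFwd_surjective k s m D hD hmD)]
  change PrimeSpectrum.zeroLocus ((RingHom.ker (cellFwd k s m D hD hmD) : Ideal (MvPolynomial (Fin N) k)) :
    Set (MvPolynomial (Fin N) k)) = _
  rw [ker_cellFwd, PrimeSpectrum.zeroLocus_span]

/-! ### The chart trace of the stratum -/

/-- Preimage of `V₊` of a set of forms of positive degree under the chart is `V` of their
dehomogenisations. [folklore] -/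
theorem chartι_preimage_zeroLocus_of_forall_mem (i : Fin (N + 1)) (S : Set (MvPolynomial (Fin (N + 1)) k))
    (hS : ∀ G ∈ S, ∃ d, 0 < d ∧ G ∈ 𝓐 d) :
    (chartι k N i).base ⁻¹' ProjectiveSpectrum.zeroLocus 𝓐 S =
      PrimeSpectrum.zeroLocus (ProjectiveSpace.dehomogenize k i '' S) := by
  ext p
  constructor
  · intro hp
    rintro f ⟨G, hG, rfl⟩
    obtain ⟨d, hd, hGd⟩ := hS G hG
    have h1 : p ∈ (chartι k N i).base ⁻¹' ProjectiveSpectrum.zeroLocus 𝓐 {G} := by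
      refine fun g hg ↦ hp ?_
      rw [Set.mem_singleton_iff] at hg
      rw [hg]; exact hG
    rw [chartι_preimage_zeroLocus_of_mem k i hd hGd] at h1
    exact h1 rfl
  · intro hp G hG
    obtain ⟨d, hd, hGd⟩ := hS G hG
    have h1 : p ∈ PrimeSpectrum.zeroLocus {ProjectiveSpace.dehomogenize k i G} := fun g hg ↦ by
      rw [Set.mem_singleton_iff] at hg
      rw [hg]; exact hp ⟨G, hG, rfl⟩
    rw [← chartι_preimage_zeroLocus_of_mem k i hd hGd] at h1
    exact h1 rfl

/-- **The chart trace of the stratum is the image of the cell map**: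
`chartι_s⁻¹ T(s, m+2) = V(y_j (j<s), y_s + rY)`. [cite: Fulton1998, Example 1.9.1] -/
theorem chartι_preimage_stratum (s m D : ℕ) (hD : s + 1 + D = N) (hmD : m ≤ D) :
    (chartι k N (cs s D hD)).base ⁻¹' stratum (k := k) s (m + 2) (by omega) =
      Set.range (cellMap k s m D hD hmD).base := by
  rw [range_cellMap, stratum, coneGens, chartι_preimage_zeroLocus_of_forall_mem]
  · congr 1
    rw [Set.image_union, Set.image_singleton, dehomogenize_splitFormAt_cs k s m D hD hmD, cellIdealGens]
    congr 1
    ext f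
    simp only [Set.mem_image, Set.mem_setOf_eq]
    constructor
    · rintro ⟨_, ⟨j, hj, rfl⟩, rfl⟩
      have hjs : j ≠ cs s D hD := fun h ↦ by rw [h] at hj; simp [cs] at hj
      obtain ⟨j', rfl⟩ := Fin.exists_succAbove_eq hjs
      refine ⟨j', ?_, (ProjectiveSpace.dehomogenize_X_succAbove k _ j').symm⟩
      have hv := val_succAbove_cs s D hD j'
      split_ifs at hv with h
      · exact h
      · omega
    · rintro ⟨j, hj, rfl⟩
      refine ⟨MvPolynomial.X ((cs s D hD).succAbove j), ⟨(cs s D hD).succAbove j, ?_, rfl⟩,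
        ProjectiveSpace.dehomogenize_X_succAbove k _ j⟩
      rw [val_succAbove_cs s D hD, if_pos hj]; exact hj
  · rintro G (⟨j, -, rfl⟩ | hG)
    · exact ⟨1, one_pos, X_mem_homogeneousSubmodule_one j⟩
    · rw [Set.mem_singleton_iff] at hG
      exact ⟨2, two_pos, hG ▸ (MvPolynomial.mem_homogeneousSubmodule 2 _).mpr
        (isHomogeneous_splitFormAt s (m + 2) (by omega))⟩

/-- **The cell of the stratum**: for a closed immersion `e : Y ↪ ℙᴺ` from a reduced scheme with
image `T(s, m+2)`, `e⁻¹ D₊(x_s) ≅ 𝔸ᴰ`, `D = N - s - 1`. [cite: Fulton1998, Example 1.9.1] -/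
theorem exists_iso_preimage_basicOpen_stratum (s m D : ℕ) (hD : s + 1 + D = N) (hmD : m ≤ D) {Y : Scheme.{u}} [IsReduced Y] (e : Y ⟶ Proj 𝓐)
    [IsClosedImmersion e] (hrange : Set.range e.base = stratum (k := k) s (m + 2) (by omega)) :
    Nonempty (↑(e ⁻¹ᵁ Proj.basicOpen 𝓐 (MvPolynomial.X (cs s D hD))) ≅
      Spec (CommRingCat.of (MvPolynomial (Fin D) k))) :=
  exists_iso_preimage_basicOpen_of_preimage_eq k e (cellMap k s m D hD hmD) (cs s D hD)
    (by rw [hrange, chartι_preimage_stratum])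

/-- **`A₁` of the cell vanishes** (`D ≥ 2`). [cite: Fulton1998, §1.9 and Example 1.9.1] -/
theorem cyclesOfDim_one_preimage_basicOpen_stratum_le (s m D : ℕ) (hD : s + 1 + D = N) (hmD : m ≤ D) (hD2 : 2 ≤ D) {Y : Scheme.{u}} [IsReduced Y]
    (e : Y ⟶ Proj 𝓐) [IsClosedImmersion e] (hrange : Set.range e.base = stratum (k := k) s (m + 2) (by omega)) :
    cyclesOfDim (↑(e ⁻¹ᵁ Proj.basicOpen 𝓐 (MvPolynomial.X (cs s D hD))) : Scheme.{u}) 1 ≤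
      ratTrivial (↑(e ⁻¹ᵁ Proj.basicOpen 𝓐 (MvPolynomial.X (cs s D hD))) : Scheme.{u}) 1 := by
  obtain ⟨ε⟩ := exists_iso_preimage_basicOpen_stratum k s m D hD hmD e hrange
  exact cyclesOfDim_le_ratTrivial_of_iso ε (AffineLineProduct.cyclesOfDim_spec_le_ratTrivial k hD2)

end Cell

/-! ### Renormalising the complementary cone by a coordinate permutation -/

section Shift

variable (k : Type u) [Field k] {N : ℕ}

attribute [local instance] MvPolynomial.gradedAlgebra ProjBaseChange.algebraBase

local notation "𝓐" => MvPolynomial.homogeneousSubmodule (Fin (N + 1)) k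

variable {k} in
/-- The forward map of the cycle: `j ↦ j + 1` on `a ≤ j < b`, `b ↦ a`, identity elsewhere. [folklore] -/
def shiftFun (a b : ℕ) (hab : a ≤ b) (hb : b < N + 1) (j : Fin (N + 1)) : Fin (N + 1) :=
  if h : a ≤ (j : ℕ) ∧ (j : ℕ) < b then ⟨(j : ℕ) + 1, by omega⟩
    else if (j : ℕ) = b then ⟨a, by omega⟩ else j

variable {k} in
/-- The backward map of the cycle. [folklore] -/
def shiftInv (a b : ℕ) (hb : b < N + 1) (j : Fin (N + 1)) : Fin (N + 1) :=
  if h : a < (j : ℕ) ∧ (j : ℕ) ≤ b then ⟨(j : ℕ) - 1, by omega⟩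
    else if (j : ℕ) = a then ⟨b, hb⟩ else j

variable {k} in
/-- Auxiliary computation (`shiftFun_val`). [folklore] -/
theorem shiftFun_val (a b : ℕ) (hab : a ≤ b) (hb : b < N + 1) (j : Fin (N + 1)) :
    ((shiftFun a b hab hb j : Fin (N + 1)) : ℕ) =
      if a ≤ (j : ℕ) ∧ (j : ℕ) < b then (j : ℕ) + 1 else if (j : ℕ) = b then a else (j : ℕ) := by
  unfold shiftFun
  split_ifs <;> rfl

variable {k} in
/-- Auxiliary computation (`shiftInv_val`). [folklore] -/
theorem shiftInv_val (a b : ℕ) (hb : b < N + 1) (j : Fin (N + 1)) :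
    ((shiftInv a b hb j : Fin (N + 1)) : ℕ) =
      if a < (j : ℕ) ∧ (j : ℕ) ≤ b then (j : ℕ) - 1 else if (j : ℕ) = a then b else (j : ℕ) := by
  unfold shiftInv
  split_ifs <;> rfl

variable {k} in
/-- **The coordinate permutation `ρ`**: the cycle `j ↦ j + 1` on `a ≤ j < b`, `b ↦ a`, identity
elsewhere. [folklore] -/
def shiftPerm (a b : ℕ) (hab : a ≤ b) (hb : b < N + 1) : Equiv.Perm (Fin (N + 1)) where
  toFun := shiftFun a b hab hb
  invFun := shiftInv a b hb
  left_inv j := by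
    refine Fin.ext ?_
    rw [shiftInv_val]
    have h := shiftFun_val a b hab hb j
    split_ifs at h ⊢ <;> omega
  right_inv j := by
    refine Fin.ext ?_
    rw [shiftFun_val]
    have h := shiftInv_val a b hb j
    split_ifs at h ⊢ <;> omega

variable {k} in
/-- Auxiliary computation (`shiftPerm_apply_val`). [folklore] -/
theorem shiftPerm_apply_val (a b : ℕ) (hab : a ≤ b) (hb : b < N + 1) (j : Fin (N + 1)) :
    ((shiftPerm a b hab hb j : Fin (N + 1)) : ℕ) =
      if a ≤ (j : ℕ) ∧ (j : ℕ) < b then (j : ℕ) + 1 else if (j : ℕ) = b then a else (j : ℕ) :=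
  shiftFun_val a b hab hb j

/-- The substitution `xⱼ ↦ x_{ρ j}` by the permuted variables. [folklore] -/
def shiftSubst (a b : ℕ) (hab : a ≤ b) (hb : b < N + 1) : Fin (N + 1) → MvPolynomial (Fin (N + 1)) k :=
  fun j ↦ MvPolynomial.X (shiftPerm a b hab hb j)

/-- The inverse substitution `xⱼ ↦ x_{ρ⁻¹ j}`. [folklore] -/
def shiftSubst' (a b : ℕ) (hab : a ≤ b) (hb : b < N + 1) : Fin (N + 1) → MvPolynomial (Fin (N + 1)) k :=
  fun j ↦ MvPolynomial.X ((shiftPerm a b hab hb).symm j)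

/-- Auxiliary computation (`isHomogeneous_shiftSubst`). [folklore] -/
theorem isHomogeneous_shiftSubst (a b : ℕ) (hab : a ≤ b) (hb : b < N + 1) (j : Fin (N + 1)) :
    (shiftSubst k a b hab hb j).IsHomogeneous 1 :=
  MvPolynomial.isHomogeneous_X k _

/-- Auxiliary computation (`isHomogeneous_shiftSubst'`). [folklore] -/
theorem isHomogeneous_shiftSubst' (a b : ℕ) (hab : a ≤ b) (hb : b < N + 1) (j : Fin (N + 1)) :
    (shiftSubst' k a b hab hb j).IsHomogeneous 1 :=
  MvPolynomial.isHomogeneous_X k _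

/-- `aeval (X ∘ ρ) = rename ρ`. [folklore] -/
theorem aeval_shiftSubst_eq (a b : ℕ) (hab : a ≤ b) (hb : b < N + 1) :
    MvPolynomial.aeval (shiftSubst k a b hab hb) = MvPolynomial.rename (shiftPerm a b hab hb) :=
  MvPolynomial.algHom_ext fun j ↦ by simp [shiftSubst, MvPolynomial.rename_X]

/-- Auxiliary computation (`aeval_shiftSubst`). [folklore] -/
theorem aeval_shiftSubst (a b : ℕ) (hab : a ≤ b) (hb : b < N + 1) (p : MvPolynomial (Fin (N + 1)) k) :
    MvPolynomial.aeval (shiftSubst k a b hab hb) p = MvPolynomial.rename (shiftPerm a b hab hb) p := by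
  rw [aeval_shiftSubst_eq]

/-- Auxiliary computation (`aeval_shiftSubst'`). [folklore] -/
theorem aeval_shiftSubst' (a b : ℕ) (hab : a ≤ b) (hb : b < N + 1) (p : MvPolynomial (Fin (N + 1)) k) :
    MvPolynomial.aeval (shiftSubst' k a b hab hb) p = MvPolynomial.rename (shiftPerm a b hab hb).symm p := by
  have h : MvPolynomial.aeval (shiftSubst' k a b hab hb) = MvPolynomial.rename (shiftPerm a b hab hb).symm :=
    MvPolynomial.algHom_ext fun j ↦ by simp [shiftSubst', MvPolynomial.rename_X]
  rw [h]

/-- Auxiliary computation (`shiftSubst_inv`). [folklore] -/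
theorem shiftSubst_inv (a b : ℕ) (hab : a ≤ b) (hb : b < N + 1) (p : MvPolynomial (Fin (N + 1)) k) :
    MvPolynomial.aeval (shiftSubst k a b hab hb) (MvPolynomial.aeval (shiftSubst' k a b hab hb) p) = p := by
  rw [aeval_shiftSubst', aeval_shiftSubst, MvPolynomial.rename_rename]
  simp

/-- Auxiliary computation (`shiftSubst_inv'`). [folklore] -/
theorem shiftSubst_inv' (a b : ℕ) (hab : a ≤ b) (hb : b < N + 1) (p : MvPolynomial (Fin (N + 1)) k) :
    MvPolynomial.aeval (shiftSubst' k a b hab hb) (MvPolynomial.aeval (shiftSubst k a b hab hb) p) = p := by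
  rw [aeval_shiftSubst', aeval_shiftSubst, MvPolynomial.rename_rename]
  simp

/-- Auxiliary computation (`linearIndependent_shiftSubst`). [folklore] -/
theorem linearIndependent_shiftSubst (a b : ℕ) (hab : a ≤ b) (hb : b < N + 1) :
    LinearIndependent k (shiftSubst k a b hab hb) :=
  (MvPolynomial.linearIndependent_X (Fin (N + 1)) k).comp _ (shiftPerm a b hab hb).injective

/-- **The renormalising automorphism `σ_ρ` of `ℙᴺ`.** [cite: Hartshorne1977, II Example 7.1.1] -/
def shiftMap (a b : ℕ) (hab : a ≤ b) (hb : b < N + 1) : Proj 𝓐 ⟶ Proj 𝓐 :=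
  ProjectiveSpace.substMapHom (shiftSubst k a b hab hb) (isHomogeneous_shiftSubst k a b hab hb)
    (shiftSubst' k a b hab hb) (isHomogeneous_shiftSubst' k a b hab hb) (shiftSubst_inv k a b hab hb)

/-- Auxiliary instance (`isIso_shiftMap`). [folklore] -/
instance isIso_shiftMap (a b : ℕ) (hab : a ≤ b) (hb : b < N + 1) : IsIso (shiftMap k a b hab hb) :=
  isIso_substMapHom _ _ _ _ _ (shiftSubst_inv' k a b hab hb)

/-- `σ_ρ` pulls `V₊(S)` back to `V₊(rename ρ '' S)`. [folklore] -/
theorem shiftMap_preimage_zeroLocus (a b : ℕ) (hab : a ≤ b) (hb : b < N + 1)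
    (S : Set (MvPolynomial (Fin (N + 1)) k)) :
    (shiftMap k a b hab hb).base ⁻¹' ProjectiveSpectrum.zeroLocus 𝓐 S =
      ProjectiveSpectrum.zeroLocus 𝓐 (MvPolynomial.rename (shiftPerm a b hab hb) '' S) := by
  rw [shiftMap, substMapHom_preimage_zeroLocus, aeval_shiftSubst_eq]

/-! ### The effect of the shift on the strata -/

/-- **Shifting a block inside the cycle**: for the cycle `ρ` on `[a, b]` and a block
`[s', s'+m') ⊆ [a, b)`, `rename ρ (q_{s',m'}) = q_{s'+1,m'}` (induction on `m'` in steps of two,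
`q_{s',m'+2} = x_{s'}x_{s'+1} + q_{s'+2,m'}`). [folklore] -/
theorem rename_shiftPerm_splitFormAt_aux (a b : ℕ) (hab : a ≤ b) (hb : b < N + 1) :
    ∀ (m' s' : ℕ) (has : a ≤ s') (hsb : s' + m' ≤ b),
      MvPolynomial.rename (shiftPerm a b hab hb) (splitFormAt k s' m' (by omega)) =
        splitFormAt k (s' + 1) m' (by omega) := by
  intro m'
  induction m' using Nat.strong_induction_on with
  | _ m' ih =>
    intro s' has hsb
    rcases m' with _ | _ | m'
    · rw [splitFormAt_zero, splitFormAt_zero, map_zero]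
    · rw [splitFormAt_one, splitFormAt_one, map_mul, MvPolynomial.rename_X]
      have h1 : shiftPerm a b hab hb (⟨s', by omega⟩ : Fin (N + 1)) = ⟨s' + 1, by omega⟩ :=
        Fin.ext (by rw [shiftPerm_apply_val, if_pos (by simp; omega)])
      rw [h1]
    · rw [splitFormAt_add_two, splitFormAt_add_two, map_add, map_mul, MvPolynomial.rename_X,
        MvPolynomial.rename_X, ih m' (by omega) (s' + 2) (by omega) (by omega)]
      have h1 : shiftPerm a b hab hb (⟨s', by omega⟩ : Fin (N + 1)) = ⟨s' + 1, by omega⟩ :=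
        Fin.ext (by rw [shiftPerm_apply_val, if_pos (by simp; omega)])
      have h2 : shiftPerm a b hab hb (⟨s' + 1, by omega⟩ : Fin (N + 1)) = ⟨s' + 1 + 1, by omega⟩ :=
        Fin.ext (by rw [shiftPerm_apply_val, if_pos (by simp; omega)])
      rw [h1, h2]

/-- **`rename ρ (q_{s+1,m}) = q_{s+2,m}`** for the cycle `ρ` on `[s+1, s+1+m]`: the quadric block
moves up by one. [folklore] -/
theorem rename_shiftPerm_splitFormAt (s m : ℕ) (h : s + 2 + m ≤ N + 1) :
    MvPolynomial.rename (shiftPerm (s + 1) (s + 1 + m) (by omega) (by omega))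
        (splitFormAt k (s + 1) m (by omega)) =
      splitFormAt k (s + 2) m h :=
  rename_shiftPerm_splitFormAt_aux k (s + 1) (s + 1 + m) (by omega) (by omega) m (s + 1) le_rfl le_rfl

/-- The cone `C(s, m) = V₊(x₀, …, x_s, q_{s+2,m})` left after peeling `D₊(x_s)` off `T(s, m+2)`.
[folklore] -/
def coneSet (s m : ℕ) (h : s + 2 + m ≤ N + 1) : Set ↥(Proj 𝓐) :=
  ProjectiveSpectrum.zeroLocus 𝓐
    ((fun j ↦ (MvPolynomial.X j : MvPolynomial (Fin (N + 1)) k)) '' {j : Fin (N + 1) | (j : ℕ) ≤ s} ∪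
      {splitFormAt k (s + 2) m h})

/-- **`σ_ρ⁻¹ T(s+1, m) = C(s, m)`.** [folklore] -/
theorem shiftMap_preimage_stratum (s m : ℕ) (h : s + 2 + m ≤ N + 1) :
    (shiftMap k (s + 1) (s + 1 + m) (by omega) (by omega)).base ⁻¹' stratum (k := k) (s + 1) m (by omega) =
      coneSet k s m h := by
  rw [stratum, coneGens, shiftMap_preimage_zeroLocus, coneSet, Set.image_union, Set.image_singleton,
    rename_shiftPerm_splitFormAt k s m h]
  congr 2
  ext f
  simp only [Set.mem_image, Set.mem_setOf_eq]
  constructor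
  · rintro ⟨_, ⟨j, hj, rfl⟩, rfl⟩
    refine ⟨shiftPerm (s + 1) (s + 1 + m) (by omega) (by omega) j, ?_, (MvPolynomial.rename_X _ _).symm⟩
    rw [shiftPerm_apply_val, if_neg (by omega), if_neg (by omega)]
    omega
  · rintro ⟨j, hj, rfl⟩
    refine ⟨MvPolynomial.X j, ⟨j, by omega, rfl⟩, ?_⟩
    rw [MvPolynomial.rename_X]
    congr 1
    refine Fin.ext ?_
    rw [shiftPerm_apply_val, if_neg (by omega), if_neg (by omega)]

/-- **The points of `T(s, m+2)` off `D₊(x_s)` lie on the cone `C(s, m)`** (`x_s ∈ 𝔭` and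
`x_s x_{s+1} + q ∈ 𝔭` give `q ∈ 𝔭`). [folklore] -/
theorem mem_coneSet_of_notMem_basicOpen (s m : ℕ) (h : s + 2 + m ≤ N + 1) {z : ↥(Proj 𝓐)}
    (hz : z ∈ stratum (k := k) s (m + 2) (by omega))
    (hx : z ∉ Proj.basicOpen 𝓐 (MvPolynomial.X (⟨s, by omega⟩ : Fin (N + 1)))) :
    z ∈ coneSet k s m h := by
  set P : ProjectiveSpectrum 𝓐 := z
  have hxs : (MvPolynomial.X ⟨s, by omega⟩ : MvPolynomial (Fin (N + 1)) k) ∈ P.asHomogeneousIdeal := by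
    by_contra h'; exact hx h'
  change _ ⊆ (P.asHomogeneousIdeal : Set (MvPolynomial (Fin (N + 1)) k)) at hz
  change _ ⊆ (P.asHomogeneousIdeal : Set (MvPolynomial (Fin (N + 1)) k))
  rintro f (⟨j, hj, rfl⟩ | hf)
  · simp only [Set.mem_setOf_eq] at hj
    by_cases hjs : (j : ℕ) = s
    · have : j = ⟨s, by omega⟩ := Fin.ext hjs
      rw [this]; exact hxs
    · exact hz (Or.inl ⟨j, by simp only [Set.mem_setOf_eq]; omega, rfl⟩)
  · rw [Set.mem_singleton_iff] at hf
    subst hf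
    have hq : splitFormAt k s (m + 2) (by omega) ∈ P.asHomogeneousIdeal := hz (Or.inr rfl)
    rw [splitFormAt_add_two] at hq
    have h2 : MvPolynomial.X ⟨s, by omega⟩ * MvPolynomial.X ⟨s + 1, by omega⟩ ∈ P.asHomogeneousIdeal :=
      Ideal.mul_mem_right _ _ hxs
    have := Ideal.sub_mem _ hq h2
    rwa [add_sub_cancel_left] at this

/-- **The generic point of the cone `C(s, m)`** (`m ≥ 3`): `σ_ρ⁻¹` of the generic point of
`T(s+1, m)`. [folklore] -/
def conePoint (s m : ℕ) (h : s + 2 + m ≤ N + 1) (hm : 3 ≤ m) : ↥(Proj 𝓐) :=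
  (inv (shiftMap k (s + 1) (s + 1 + m) (by omega) (by omega))).base
    (stratumPoint (k := k) (s + 1) m (by omega) hm)

/-- `σ_ρ (conePoint) = stratumPoint`. [folklore] -/
theorem shiftMap_conePoint (s m : ℕ) (h : s + 2 + m ≤ N + 1) (hm : 3 ≤ m) :
    (shiftMap k (s + 1) (s + 1 + m) (by omega) (by omega)).base (conePoint k s m h hm) =
      stratumPoint (k := k) (s + 1) m (by omega) hm := by
  rw [conePoint, ← Scheme.Hom.comp_apply, IsIso.inv_hom_id]
  rfl

/-- **`closure {conePoint} = C(s, m)`**: the cone is irreducible. [folklore] -/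
theorem closure_conePoint (s m : ℕ) (h : s + 2 + m ≤ N + 1) (hm : 3 ≤ m) :
    closure {conePoint k s m h hm} = coneSet k s m h := by
  have hpre : (shiftMap k (s + 1) (s + 1 + m) (by omega) (by omega)).base ⁻¹'
      {stratumPoint (k := k) (s + 1) m (by omega) hm} = {conePoint k s m h hm} := by
    ext z
    simp only [Set.mem_preimage, Set.mem_singleton_iff]
    constructor
    · intro hz
      apply (shiftMap k (s + 1) (s + 1 + m) (by omega) (by omega)).homeomorph.injective
      change (shiftMap k (s + 1) (s + 1 + m) _ _).base z =
        (shiftMap k (s + 1) (s + 1 + m) _ _).base (conePoint k s m h hm)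
      rw [hz, shiftMap_conePoint]
    · rintro rfl
      exact shiftMap_conePoint k s m h hm
  rw [← hpre]
  have hcl := (shiftMap k (s + 1) (s + 1 + m) (by omega) (by omega)).homeomorph.preimage_closure
    {stratumPoint (k := k) (N := N) (s + 1) m (by omega) hm}
  change (shiftMap k (s + 1) (s + 1 + m) _ _).base ⁻¹' closure {stratumPoint (k := k) (s + 1) m _ hm} =
    closure ((shiftMap k (s + 1) (s + 1 + m) _ _).base ⁻¹' {stratumPoint (k := k) (s + 1) m _ hm}) at hcl
  rw [← hcl, closure_stratumPoint, shiftMap_preimage_stratum]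

/-- The generic point lies on the cone. [folklore] -/
theorem conePoint_mem (s m : ℕ) (h : s + 2 + m ≤ N + 1) (hm : 3 ≤ m) :
    conePoint k s m h hm ∈ coneSet k s m h := by
  rw [← closure_conePoint k s m h hm]
  exact subset_closure rfl

end Shift

end ProjectiveSpaceCells

end Literature.AlgebraicGeometry.Motives
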